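import Summits.Ventures.Crystal3D.Theorems.StickyWulffConstantCoaxialWallLawTailResidueDefsM
import Summits.Ventures.Crystal3D.Theorems.StickyWulffConstantCoaxialWallLawTailResidueClosingL
import HarnessLib

/-!
# The lane-F closing theorem on the SPLIT T4: `… → LensCert s → MonoCapture → ModuleCapture → MultiGrainSmall s → CoaxialWallLaw`
# (crux `CoaxialWallLaw`, stmt-Ventures-19481; cf-p1 DECISION (cxxxii) «T4 SPLIT (O1) = GO»; definitions `…TailResidueDefsM`)

HONEST FRAMING. Venture `Summits/Ventures/Crystal3D` (cell `crystal3d-full`); helper `--supports` the crux `CoaxialWallLaw`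
(stmt-Ventures-19481, `route-Ventures-StickyWulffConstant`), registered line 'CoaxialWallLawCertificates' (planner cf-p1).  Rung credit;
F-C1 NOT moved.  `…TailResidueClosingL` (p700155) closed the crux by name on `LensCert (2√6) ∧ LensSoundness`; F-TAIL-g10 showed that
`LensSoundness`'s canonical-typing proof covers mono-module windows only, and (cxxxii) re-cut it as `MonoCapture ∧ ModuleCapture ∧
MultiGrainSmall` (`…TailResidueDefsM`, p705041).  This file is the one-screen composition on the split:
* `endRowJointTailA_of_lensCert_mono` — the joint tail from the two on-site flats, `LensCert s`, `MonoCapture`, `ModuleCapture`,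
  `MultiGrainSmall s` (mono-module windows: capture ⇒ dominating lens type ⇒ certificate; multi-grain windows: the seam bound; deletions:
  the on-site certificates via `endRowJointTailA_of_residue`);
* `endRowJointA_of_lensCertificates_mono`;
* **`coaxialWallLaw_of_lensCertificates_mono_explicit : KissingGap (5/2) → KissingClassification (5/2) → StarPairFar → P5Exhaustion →
  EndRowOnSiteFlatA v2 (9/2) 𝒰_cx → EndRowOnSiteJointFlatA v2 (2√6) 𝒰_cx → LensCert (2√6) → MonoCapture → ModuleCapture →
  MultiGrainSmall (2√6) → CoaxialWallLaw`** — the census-free cone for 'Certificates' v3 (`stub_monoCapture`, `stub_moduleCapture`,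
  `stub_multiGrainSmall`); `MonoCapture` itself is discharged in `…TailResidueMonoCapture` (nine-hypothesis form there).
REMAINING BY-NAME DEBTS: `P5Exhaustion`; the two on-site flats [certified]; `LensCert (2√6)` [cf-p2 §69 + capdec (69.0⁶)]; `ModuleCapture`
[generalized class collapse; finite-check evidence g10-calc/gcc_check.py: 516 deep frames, 0 failures]; `MultiGrainSmall (2√6)` [seam regime;
numerics ≤ 1.7].  WHAT THIS IS NOT: not the certificates, not those three; F-C1 not moved.
-/

noncomputable section

namespace Summit.Ventures.Crystal3D.Theorems

open Summit.Ventures.Crystal3D Finset TailResidue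
open scoped InnerProductSpace

/-- **The joint tail from the certificate and the split T4** (line `s`): on a mono-module window `ModuleCapture` + `MonoCapture` give a
dominating lens type (bounded by `LensCert`), on a multi-grain window `MultiGrainSmall` bounds the summand directly; deletions go to the
on-site certificates (`endRowJointTailA_of_residue`). -/
theorem endRowJointTailA_of_lensCert_mono {s : ℝ} (honT : EndRowOnSiteFlatA WordVersion.v2 s coaxialModuleUniverse)
    (honJ : EndRowOnSiteJointFlatA WordVersion.v2 s coaxialModuleUniverse) (hcert : LensCert s)
    (hmono : MonoCapture) (hmod : ModuleCapture) (hmulti : MultiGrainSmall s) : EndRowJointTailA WordVersion.v2 s coaxialModuleUniverse :=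
  endRowJointTailA_of_residue honT honJ fun L X hX z hz hdeg hoff => by
    by_cases hM : MonoModuleAt L X z
    · rcases hmono L X hX z hz hdeg hoff (hmod L X hX z hz hdeg hoff hM) with h | ⟨τ, hwf, hre, L₀, hL₀, hle⟩
      · exact Or.inl h
      · exact Or.inr (hle.trans (hcert τ hwf hre L₀ hL₀))
    · rcases hmulti L X hX z hz hdeg hoff hM with h | h
      · exact Or.inl h
      · exact Or.inr h

/-- **T-F2's joint row by name (M)**: bnb-ucx at `9/2`, 'jointrow' at `2√6`, `LensCert (2√6)`, `MonoCapture`, `ModuleCapture`,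
`MultiGrainSmall (2√6)`. -/
theorem endRowJointA_of_lensCertificates_mono (honT : EndRowOnSiteFlatA WordVersion.v2 (9 / 2) coaxialModuleUniverse)
    (honJ : EndRowOnSiteJointFlatA WordVersion.v2 (2 * Real.sqrt 6) coaxialModuleUniverse)
    (hcert : LensCert (2 * Real.sqrt 6)) (hmono : MonoCapture) (hmod : ModuleCapture) (hmulti : MultiGrainSmall (2 * Real.sqrt 6)) :
    EndRowJointA WordVersion.v2 (2 * Real.sqrt 6) :=
  endRowJointA_v2_twoSqrtSix_cx honT honJ
    (endRowJointTailA_of_lensCert_mono (endRowOnSiteFlatA_mono_const nine_halves_le_two_sqrt_six honT) honJ hcert hmono hmod hmulti)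

/-- **LANE F'S CRUX BY NAME (M), CENSUS-FREE CONE (for the re-registration 'Certificates' v3):
`KissingGap (5/2) → KissingClassification (5/2) → StarPairFar → P5Exhaustion → EndRowOnSiteFlatA v2 (9/2) 𝒰_cx →
EndRowOnSiteJointFlatA v2 (2√6) 𝒰_cx → LensCert (2√6) → MonoCapture → ModuleCapture → MultiGrainSmall (2√6) → CoaxialWallLaw`.** -/
theorem coaxialWallLaw_of_lensCertificates_mono_explicit (hg : KissingGap (5 / 2)) (hc : KissingClassification (5 / 2))
    (hSP : StarPairFar) (hE1 : P5Exhaustion) (honT : EndRowOnSiteFlatA WordVersion.v2 (9 / 2) coaxialModuleUniverse)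
    (honJ : EndRowOnSiteJointFlatA WordVersion.v2 (2 * Real.sqrt 6) coaxialModuleUniverse)
    (hcert : LensCert (2 * Real.sqrt 6)) (hmono : MonoCapture) (hmod : ModuleCapture) (hmulti : MultiGrainSmall (2 * Real.sqrt 6)) :
    Summit.Ventures.Crystal3D.Theses.StickyWulffConstant.CoaxialWallLaw :=
  coaxialWallLaw_of_jointA_explicit WordVersion.v2 hg hc two_sqrt_six_pos le_rfl
    (endRowJointA_of_lensCertificates_mono honT honJ hcert hmono hmod hmulti) hE1 hSP

end Summit.Ventures.Crystal3D.Theorems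

end
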